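import Mathlib
import Summits.Ventures.PercRepro2.A3PendantB
import Summits.Ventures.PercRepro2.A3RootEdgeMeans

/-!
# The a₃-exploration fibres at a leaf `a₃` attached to ANY vertex `v`: transfer to the `v`-fibres under
the open pin, and the leaf split of every fibre sum of `btw`
(blind cell PercRepro2, night-1 g31; proofs/NIGHT1-G31.md; the assembly is A3PendantFree.lean)

Let `a₃` be a leaf attached to `v` by the edge `f` of weight `t = p f`, and `p₁ = p[f ↦ 1]`.  The fibre
of the `a₃`-exploration at a set `W ∋ v` is the fibre of the `v`-exploration with `f` open
(`fibre_leaf_eq_of_mem`: `Q ∩ {C(a₃) = W} = Q ∩ {C(v) = W} ∩ {f open}`), so its masses are `t` times the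
`v`-fibre masses under `p₁` (`prob_fibre_leaf_inter`, `mW_leaf_of_mem`, `Ssig_leaf_of_mem`,
`Su_leaf_of_mem`, `SF_leaf_of_mem` — the latter with the `a₃`-centring `γ` kept, `RootEdge.SFg`); the fibre
`{a₃}` is `Q ∩ {f closed}` (A3PendantOFibres) and every other fibre is null, while a `v`-fibre at a set
not containing `v` is empty (`fibre_eq_empty_of_notMem_self`).  Hence every fibre sum of `btw` splits as
«the `{a₃}`-term + `t` × the `v`-sum under `p₁`» (`sum_term_leaf`, `sum_Ssig_leaf`, `sum_SF_leaf`,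
`sum_termA_leaf`, `sum_SuA_leaf`, `prob_PD_leaf_free`: `D = m_{a₃} + t D_v(p₁)`).  Standard axioms.
-/

namespace Summit.Ventures.PercRepro2

open UnionCluster CovForm PendantRoot PendantO

namespace CovForm

namespace A3Fibre

/-! ## The fibres of the leaf at an unmarked vertex -/

section LeafFibresFree

variable {V : Type*} {E : Type*} [Fintype V] [DecidableEq V] [Fintype E] [DecidableEq E]
  {ends : E → Sym2 V} {f : E} {a₃ v : V}

omit [Fintype V] [DecidableEq V] [Fintype E] [DecidableEq E] in
/-- With `f` open the cluster of the leaf is the cluster of `v`. -/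
lemma cluster_leaf_open (hf : ends f = s(a₃, v)) {ω : Config E} (hωf : ω f = true) :
    cluster ends ω a₃ = cluster ends ω v :=
  cluster_eq_of_conn (conn_of_openAdj ⟨f, hωf, hf⟩)

omit [Fintype V] [DecidableEq V] [Fintype E] [DecidableEq E] in
/-- **The fibre of the leaf at a set containing `v` is the fibre of `v` with `f` open.** -/
lemma fibre_leaf_eq_of_mem (hf : ends f = s(a₃, v)) (hleaf : ∀ e, a₃ ∈ ends e → e = f)
    (h3v : a₃ ≠ v) (a₁ a₂ : V) {W : Finset V} (hvW : v ∈ W) :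
    fibre ends a₁ a₂ a₃ W = fibre ends a₁ a₂ v W ∩ openEdge f := by
  ext ω
  simp only [fibre, Set.mem_inter_iff, mem_clusterEvent, mem_openEdge]
  constructor
  · rintro ⟨hQ, hc⟩
    have hopen : ω f = true := by
      cases h : ω f
      · exfalso
        have hv : v ∈ cluster ends ω a₃ := by rw [hc]; exact Finset.mem_coe.2 hvW
        rw [cluster_leaf_closed hf hleaf h3v h] at hv
        simp only [Finset.coe_singleton, Set.mem_singleton_iff] at hv
        exact h3v hv.symm
      · rfl
    exact ⟨⟨hQ, by rw [← cluster_leaf_open hf hopen, hc]⟩, hopen⟩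
  · rintro ⟨⟨hQ, hc⟩, hopen⟩
    exact ⟨hQ, by rw [cluster_leaf_open hf hopen, hc]⟩

omit [Fintype V] [DecidableEq V] [Fintype E] [DecidableEq E] in
/-- The fibre of `v` at a set not containing `v` is empty. -/
lemma fibre_eq_empty_of_notMem_self (ends : E → Sym2 V) (a₁ a₂ v : V) {W : Finset V}
    (hvW : v ∉ W) : fibre ends a₁ a₂ v W = ∅ := by
  ext ω
  simp only [fibre, Set.mem_inter_iff, mem_clusterEvent, Set.mem_empty_iff_false, iff_false,
    not_and]
  intro _ hc
  apply hvW
  have hv := mem_cluster_self ends ω v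
  rw [hc] at hv
  exact Finset.mem_coe.1 hv

variable {R : Type*} [CommRing R]

omit [Fintype V] [DecidableEq V] in
/-- **Transfer of the leaf fibre**: `P_p(Q ∩ {C(a₃) = W} ∩ X) = t · P_{p₁}(Q ∩ {C(v) = W} ∩ X)` for `v ∈ W`. -/
lemma prob_fibre_leaf_inter (p : E → R) (hf : ends f = s(a₃, v))
    (hleaf : ∀ e, a₃ ∈ ends e → e = f) (h3v : a₃ ≠ v) (a₁ a₂ : V) {W : Finset V} (hvW : v ∈ W)
    (X : Set (Config E)) :
    prob p (fibre ends a₁ a₂ a₃ W ∩ X) =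
      p f * prob (Function.update p f 1) (fibre ends a₁ a₂ v W ∩ X) := by
  rw [fibre_leaf_eq_of_mem hf hleaf h3v a₁ a₂ hvW, Set.inter_right_comm, prob_inter_openEdge]

omit [Fintype V] [DecidableEq V] in
/-- `m_W(a₃) = t · m_W(v at p₁)` for `v ∈ W`. -/
lemma mW_leaf_of_mem (p : E → R) (hf : ends f = s(a₃, v)) (hleaf : ∀ e, a₃ ∈ ends e → e = f)
    (h3v : a₃ ≠ v) (a₁ a₂ : V) {W : Finset V} (hvW : v ∈ W) :
    mW p ends a₁ a₂ a₃ W = p f * mW (Function.update p f 1) ends a₁ a₂ v W := by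
  have h := prob_fibre_leaf_inter p hf hleaf h3v a₁ a₂ hvW Set.univ
  simpa only [Set.inter_univ, mW] using h

omit [Fintype V] [DecidableEq V] in
/-- `Ssig_x(a₃, W) = t · Ssig_x(v at p₁, W)` for `v ∈ W`. -/
lemma Ssig_leaf_of_mem (p : E → R) (hf : ends f = s(a₃, v)) (hleaf : ∀ e, a₃ ∈ ends e → e = f)
    (h3v : a₃ ≠ v) (a₁ a₂ x : V) {W : Finset V} (hvW : v ∈ W) :
    Ssig p ends a₁ a₂ a₃ x W = p f * Ssig (Function.update p f 1) ends a₁ a₂ v x W := by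
  unfold Ssig
  rw [prob_fibre_leaf_inter p hf hleaf h3v a₁ a₂ hvW, prob_fibre_leaf_inter p hf hleaf h3v a₁ a₂ hvW]
  ring

omit [Fintype V] [DecidableEq V] in
/-- `Su_x(a₃, W) = t · Su_x(v at p₁, W)` for `v ∈ W`. -/
lemma Su_leaf_of_mem (p : E → R) (hf : ends f = s(a₃, v)) (hleaf : ∀ e, a₃ ∈ ends e → e = f)
    (h3v : a₃ ≠ v) (a₁ a₂ x : V) {W : Finset V} (hvW : v ∈ W) :
    Su p ends a₁ a₂ a₃ x W = p f * Su (Function.update p f 1) ends a₁ a₂ v x W := by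
  unfold Su
  rw [prob_fibre_leaf_inter p hf hleaf h3v a₁ a₂ hvW, prob_fibre_leaf_inter p hf hleaf h3v a₁ a₂ hvW]
  ring

omit [Fintype V] [DecidableEq V] in
/-- The mass of a `v`-fibre at a set not containing `v` vanishes. -/
lemma mW_eq_zero_of_notMem_self (p : E → R) (ends : E → Sym2 V) (a₁ a₂ v : V) {W : Finset V}
    (hvW : v ∉ W) : mW p ends a₁ a₂ v W = 0 := by
  unfold mW
  rw [fibre_eq_empty_of_notMem_self ends a₁ a₂ v hvW, prob_empty]

omit [Fintype V] [DecidableEq V] in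
/-- `Ssig` on a `v`-fibre at a set not containing `v` vanishes. -/
lemma Ssig_eq_zero_of_notMem_self (p : E → R) (ends : E → Sym2 V) (a₁ a₂ v x : V) {W : Finset V}
    (hvW : v ∉ W) : Ssig p ends a₁ a₂ v x W = 0 := by
  unfold Ssig
  simp only [fibre_eq_empty_of_notMem_self ends a₁ a₂ v hvW, Set.empty_inter, prob_empty, sub_self]

omit [Fintype V] [DecidableEq V] in
/-- `Su` on a `v`-fibre at a set not containing `v` vanishes. -/
lemma Su_eq_zero_of_notMem_self (p : E → R) (ends : E → Sym2 V) (a₁ a₂ v x : V) {W : Finset V}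
    (hvW : v ∉ W) : Su p ends a₁ a₂ v x W = 0 := by
  unfold Su
  simp only [fibre_eq_empty_of_notMem_self ends a₁ a₂ v hvW, Set.empty_inter, prob_empty, add_zero]

end LeafFibresFree

/-! ## The leaf split of the fibre sums -/

section LeafSumsFree

variable {V : Type*} {E : Type*} [Fintype V] [DecidableEq V] [Fintype E] [DecidableEq E]
  {R : Type*} [Field R] [LinearOrder R] [IsStrictOrderedRing R]
  {ends : E → Sym2 V} {f : E} {a₃ v : V}

omit [Fintype V] [DecidableEq V] [Fintype E] [DecidableEq E] [LinearOrder R] [IsStrictOrderedRing R] in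
/-- `(t a)(t b)/(t c) = t (a b / c)` (also at `t = 0`, by Lean's `x / 0 = 0`). -/
lemma mul_div_leaf_aux (t a b c : R) : t * a * (t * b) / (t * c) = t * (a * b / c) := by
  rcases eq_or_ne t 0 with rfl | ht
  · simp
  · rw [show t * a * (t * b) = t * (t * a * b) by ring, mul_div_mul_left _ _ ht]
    ring

omit [Fintype V] [DecidableEq V] [Fintype E] [DecidableEq E] [LinearOrder R] [IsStrictOrderedRing R] in
/-- `(x(1−t))(y(1−t))/(Q(1−t)) = (1 − t)(x y / Q)` (also at `t = 1`). -/
lemma div_leaf_aux (x y Q t : R) : x * (1 - t) * (y * (1 - t)) / (Q * (1 - t)) = (1 - t) * (x * y / Q) := by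
  rcases eq_or_ne (1 - t) 0 with h | h
  · rw [h]; simp
  · rw [show x * (1 - t) * (y * (1 - t)) = (1 - t) * ((1 - t) * x * y) by ring,
      show Q * (1 - t) = (1 - t) * Q by ring, mul_div_mul_left _ _ h]
    ring

omit [Fintype V] [DecidableEq V] [Fintype E] [DecidableEq E] [LinearOrder R] [IsStrictOrderedRing R] in
/-- `v ∉ {a₃}`. -/
lemma notMem_singleton_of_ne (h3v : a₃ ≠ v) : v ∉ ({a₃} : Finset V) := by
  rw [Finset.mem_singleton]; exact Ne.symm h3v

omit [Fintype E] [DecidableEq E] [LinearOrder R] [IsStrictOrderedRing R] in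
/-- `{a₃}` is an `A`-fibre when neither root is the leaf. -/
lemma singleton_mem_fibresA {a₁ a₂ : V} (h31 : a₃ ≠ a₁) (h32 : a₃ ≠ a₂) :
    ({a₃} : Finset V) ∈ fibresA a₁ a₂ := by
  rw [fibresA, Finset.mem_filter]
  exact ⟨Finset.mem_univ _, by simp [Finset.mem_singleton, Ne.symm h31, Ne.symm h32]⟩

omit [LinearOrder R] [IsStrictOrderedRing R] in
/-- `P(PD) = ∑_{W ∈ A} m_W` over `fibresA`. -/
lemma prob_PD_eq_fibresA (p : E → R) (ends : E → Sym2 V) (a₁ a₂ a₃ : V) :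
    prob p (PDEvent ends a₁ a₂ a₃) = ∑ W ∈ fibresA a₁ a₂, mW p ends a₁ a₂ a₃ W := by
  rw [prob_PD_eq, fibresA, Finset.sum_filter]

omit [LinearOrder R] [IsStrictOrderedRing R] in
/-- `D_o = ∑_{W ∈ A} Su_o W` over `fibresA`. -/
lemma Do_eq_fibresA (p : E → R) (ends : E → Sym2 V) (o a₁ a₂ a₃ : V) :
    Do p ends o a₁ a₂ a₃ = ∑ W ∈ fibresA a₁ a₂, Su p ends a₁ a₂ a₃ o W := by
  rw [Do_eq, fibresA, Finset.sum_filter]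

/-- When `P(PD_v) = 0` every `A`-sum of `Su` vanishes. -/
lemma sum_Su_fibresA_eq_zero_of_PD_eq_zero {p : E → R} (hp : IsProbVec p) (ends : E → Sym2 V)
    (a₁ a₂ v x : V) (hD : prob p (PDEvent ends a₁ a₂ v) = 0) :
    ∑ W ∈ fibresA a₁ a₂, Su p ends a₁ a₂ v x W = 0 := by
  rw [prob_PD_eq_fibresA] at hD
  have hz : ∀ W ∈ fibresA a₁ a₂, mW p ends a₁ a₂ v W = 0 :=
    (Finset.sum_eq_zero_iff_of_nonneg (fun W _ => prob_nonneg hp _)).1 hD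
  exact Finset.sum_eq_zero fun W hW => Su_eq_zero_of_mW_eq_zero hp ends a₁ a₂ v x W (hz W hW)

omit [Fintype V] [LinearOrder R] [IsStrictOrderedRing R] in
/-- The pointwise leaf split of `m_W`. -/
lemma mW_leaf_split (p : E → R) (hf : ends f = s(a₃, v)) (hleaf : ∀ e, a₃ ∈ ends e → e = f)
    (h3v : a₃ ≠ v) (a₁ a₂ : V) (W : Finset V) :
    mW p ends a₁ a₂ a₃ W = (if W = {a₃} then mW p ends a₁ a₂ a₃ {a₃} else 0) +
      p f * mW (Function.update p f 1) ends a₁ a₂ v W := by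
  by_cases hW : W = {a₃}
  · subst hW
    rw [if_pos rfl, mW_eq_zero_of_notMem_self _ ends a₁ a₂ v (notMem_singleton_of_ne h3v), mul_zero,
      add_zero]
  · rw [if_neg hW, zero_add]
    by_cases hv : v ∈ W
    · exact mW_leaf_of_mem p hf hleaf h3v a₁ a₂ hv
    · rw [mW_eq_zero_of_notMem_self _ ends a₁ a₂ v hv, mul_zero]
      exact mW_eq_zero_of_leaf p hf hleaf h3v a₁ a₂ hW hv

omit [Fintype V] in
/-- The pointwise leaf split of `Ssig`. -/
lemma Ssig_leaf_split {p : E → R} (hp : IsProbVec p) (hf : ends f = s(a₃, v))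
    (hleaf : ∀ e, a₃ ∈ ends e → e = f) (h3v : a₃ ≠ v) (a₁ a₂ x : V) (W : Finset V) :
    Ssig p ends a₁ a₂ a₃ x W = (if W = {a₃} then Ssig p ends a₁ a₂ a₃ x {a₃} else 0) +
      p f * Ssig (Function.update p f 1) ends a₁ a₂ v x W := by
  by_cases hW : W = {a₃}
  · subst hW
    rw [if_pos rfl, Ssig_eq_zero_of_notMem_self _ ends a₁ a₂ v x (notMem_singleton_of_ne h3v),
      mul_zero, add_zero]
  · rw [if_neg hW, zero_add]
    by_cases hv : v ∈ W
    · exact Ssig_leaf_of_mem p hf hleaf h3v a₁ a₂ x hv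
    · rw [Ssig_eq_zero_of_notMem_self _ ends a₁ a₂ v x hv, mul_zero]
      exact Ssig_eq_zero_of_mW_eq_zero hp ends a₁ a₂ a₃ x W
        (mW_eq_zero_of_leaf p hf hleaf h3v a₁ a₂ hW hv)

omit [Fintype V] in
/-- The pointwise leaf split of `Su`. -/
lemma Su_leaf_split {p : E → R} (hp : IsProbVec p) (hf : ends f = s(a₃, v))
    (hleaf : ∀ e, a₃ ∈ ends e → e = f) (h3v : a₃ ≠ v) (a₁ a₂ x : V) (W : Finset V) :
    Su p ends a₁ a₂ a₃ x W = (if W = {a₃} then Su p ends a₁ a₂ a₃ x {a₃} else 0) +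
      p f * Su (Function.update p f 1) ends a₁ a₂ v x W := by
  by_cases hW : W = {a₃}
  · subst hW
    rw [if_pos rfl, Su_eq_zero_of_notMem_self _ ends a₁ a₂ v x (notMem_singleton_of_ne h3v),
      mul_zero, add_zero]
  · rw [if_neg hW, zero_add]
    by_cases hv : v ∈ W
    · exact Su_leaf_of_mem p hf hleaf h3v a₁ a₂ x hv
    · rw [Su_eq_zero_of_notMem_self _ ends a₁ a₂ v x hv, mul_zero]
      exact Su_eq_zero_of_mW_eq_zero hp ends a₁ a₂ a₃ x W
        (mW_eq_zero_of_leaf p hf hleaf h3v a₁ a₂ hW hv)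

omit [Fintype V] [LinearOrder R] [IsStrictOrderedRing R] in
/-- `SF(a₃, W) = t · SFg(v at p₁, γ, W)` for `v ∈ W`, with `γ` the `a₃`-centring. -/
lemma SF_leaf_of_mem (p : E → R) (hf : ends f = s(a₃, v)) (hleaf : ∀ e, a₃ ∈ ends e → e = f)
    (h3v : a₃ ≠ v) (o a₁ a₂ : V) {W : Finset V} (hvW : v ∈ W) :
    SF p ends o a₁ a₂ a₃ W =
      p f * RootEdge.SFg (Function.update p f 1) ends o a₁ a₂ v (gamma p ends o a₁ a₂ a₃) W := by
  unfold SF RootEdge.SFg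
  rw [Ssig_leaf_of_mem p hf hleaf h3v a₁ a₂ o hvW, Su_leaf_of_mem p hf hleaf h3v a₁ a₂ o hvW,
    mW_leaf_of_mem p hf hleaf h3v a₁ a₂ hvW]
  ring

omit [Fintype V] [LinearOrder R] [IsStrictOrderedRing R] in
/-- `SFg(v, γ, {a₃}) = 0`: the `v`-fibre at `{a₃}` is empty. -/
lemma SFg_singleton_eq_zero (p : E → R) (o a₁ a₂ : V) (h3v : a₃ ≠ v) (γ : R) :
    RootEdge.SFg p ends o a₁ a₂ v γ {a₃} = 0 := by
  unfold RootEdge.SFg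
  rw [Ssig_eq_zero_of_notMem_self _ ends a₁ a₂ v o (notMem_singleton_of_ne h3v),
    Su_eq_zero_of_notMem_self _ ends a₁ a₂ v o (notMem_singleton_of_ne h3v),
    mW_eq_zero_of_notMem_self _ ends a₁ a₂ v (notMem_singleton_of_ne h3v)]
  ring

omit [Fintype V] [LinearOrder R] [IsStrictOrderedRing R] in
/-- `SFg(v, γ, W) = 0` when `v ∉ W`. -/
lemma SFg_eq_zero_of_notMem_self (p : E → R) (o a₁ a₂ : V) {W : Finset V} (hvW : v ∉ W) (γ : R) :
    RootEdge.SFg p ends o a₁ a₂ v γ W = 0 := by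
  unfold RootEdge.SFg
  rw [Ssig_eq_zero_of_notMem_self _ ends a₁ a₂ v o hvW, Su_eq_zero_of_notMem_self _ ends a₁ a₂ v o hvW,
    mW_eq_zero_of_notMem_self _ ends a₁ a₂ v hvW]
  ring

omit [Fintype V] in
/-- The pointwise leaf split of `SF`. -/
lemma SF_leaf_split {p : E → R} (hp : IsProbVec p) (hf : ends f = s(a₃, v))
    (hleaf : ∀ e, a₃ ∈ ends e → e = f) (h3v : a₃ ≠ v) (o a₁ a₂ : V) (W : Finset V) :
    SF p ends o a₁ a₂ a₃ W = (if W = {a₃} then SF p ends o a₁ a₂ a₃ {a₃} else 0) +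
      p f * RootEdge.SFg (Function.update p f 1) ends o a₁ a₂ v (gamma p ends o a₁ a₂ a₃) W := by
  by_cases hW : W = {a₃}
  · subst hW
    rw [if_pos rfl, SFg_singleton_eq_zero _ o a₁ a₂ h3v, mul_zero, add_zero]
  · rw [if_neg hW, zero_add]
    by_cases hv : v ∈ W
    · exact SF_leaf_of_mem p hf hleaf h3v o a₁ a₂ hv
    · rw [SFg_eq_zero_of_notMem_self _ o a₁ a₂ hv, mul_zero]
      exact SF_eq_zero_of_mW_eq_zero hp ends o a₁ a₂ a₃ W (mW_eq_zero_of_leaf p hf hleaf h3v a₁ a₂ hW hv)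

omit [Fintype V] in
/-- The pointwise leaf split of the ratio term `Ssig_b · SF / m_W`. -/
lemma term_leaf_split {p : E → R} (hp : IsProbVec p) (hf : ends f = s(a₃, v))
    (hleaf : ∀ e, a₃ ∈ ends e → e = f) (h3v : a₃ ≠ v) (o a₁ a₂ b : V) (W : Finset V) :
    Ssig p ends a₁ a₂ a₃ b W * SF p ends o a₁ a₂ a₃ W / mW p ends a₁ a₂ a₃ W =
      (if W = {a₃} then
        Ssig p ends a₁ a₂ a₃ b {a₃} * SF p ends o a₁ a₂ a₃ {a₃} / mW p ends a₁ a₂ a₃ {a₃} else 0) +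
      p f * (Ssig (Function.update p f 1) ends a₁ a₂ v b W *
        RootEdge.SFg (Function.update p f 1) ends o a₁ a₂ v (gamma p ends o a₁ a₂ a₃) W /
        mW (Function.update p f 1) ends a₁ a₂ v W) := by
  by_cases hW : W = {a₃}
  · subst hW
    rw [if_pos rfl, Ssig_eq_zero_of_notMem_self _ ends a₁ a₂ v b (notMem_singleton_of_ne h3v),
      zero_mul, zero_div, mul_zero, add_zero]
  · rw [if_neg hW, zero_add]
    by_cases hv : v ∈ W
    · rw [Ssig_leaf_of_mem p hf hleaf h3v a₁ a₂ b hv, SF_leaf_of_mem p hf hleaf h3v o a₁ a₂ hv,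
        mW_leaf_of_mem p hf hleaf h3v a₁ a₂ hv]
      exact mul_div_leaf_aux _ _ _ _
    · rw [Ssig_eq_zero_of_notMem_self _ ends a₁ a₂ v b hv, zero_mul, zero_div, mul_zero,
        Ssig_eq_zero_of_mW_eq_zero hp ends a₁ a₂ a₃ b W (mW_eq_zero_of_leaf p hf hleaf h3v a₁ a₂ hW hv),
        zero_mul, zero_div]

omit [Fintype V] in
/-- The pointwise leaf split of the `A`-ratio term `Su_b · Su_o / m_W`. -/
lemma termA_leaf_split {p : E → R} (hp : IsProbVec p) (hf : ends f = s(a₃, v))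
    (hleaf : ∀ e, a₃ ∈ ends e → e = f) (h3v : a₃ ≠ v) (o a₁ a₂ b : V) (W : Finset V) :
    Su p ends a₁ a₂ a₃ b W * Su p ends a₁ a₂ a₃ o W / mW p ends a₁ a₂ a₃ W =
      (if W = {a₃} then
        Su p ends a₁ a₂ a₃ b {a₃} * Su p ends a₁ a₂ a₃ o {a₃} / mW p ends a₁ a₂ a₃ {a₃} else 0) +
      p f * (Su (Function.update p f 1) ends a₁ a₂ v b W * Su (Function.update p f 1) ends a₁ a₂ v o W /
        mW (Function.update p f 1) ends a₁ a₂ v W) := by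
  by_cases hW : W = {a₃}
  · subst hW
    rw [if_pos rfl, Su_eq_zero_of_notMem_self _ ends a₁ a₂ v b (notMem_singleton_of_ne h3v),
      zero_mul, zero_div, mul_zero, add_zero]
  · rw [if_neg hW, zero_add]
    by_cases hv : v ∈ W
    · rw [Su_leaf_of_mem p hf hleaf h3v a₁ a₂ b hv, Su_leaf_of_mem p hf hleaf h3v a₁ a₂ o hv,
        mW_leaf_of_mem p hf hleaf h3v a₁ a₂ hv]
      exact mul_div_leaf_aux _ _ _ _
    · rw [Su_eq_zero_of_notMem_self _ ends a₁ a₂ v b hv, zero_mul, zero_div, mul_zero,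
        Su_eq_zero_of_mW_eq_zero hp ends a₁ a₂ a₃ b W (mW_eq_zero_of_leaf p hf hleaf h3v a₁ a₂ hW hv),
        zero_mul, zero_div]

/-- **The first ratio sum splits at the leaf.** -/
lemma sum_term_leaf {p : E → R} (hp : IsProbVec p) (hf : ends f = s(a₃, v))
    (hleaf : ∀ e, a₃ ∈ ends e → e = f) (h3v : a₃ ≠ v) (o a₁ a₂ b : V) :
    ∑ W : Finset V, Ssig p ends a₁ a₂ a₃ b W * SF p ends o a₁ a₂ a₃ W / mW p ends a₁ a₂ a₃ W =
      Ssig p ends a₁ a₂ a₃ b {a₃} * SF p ends o a₁ a₂ a₃ {a₃} / mW p ends a₁ a₂ a₃ {a₃} +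
        p f * ∑ W : Finset V, Ssig (Function.update p f 1) ends a₁ a₂ v b W *
          RootEdge.SFg (Function.update p f 1) ends o a₁ a₂ v (gamma p ends o a₁ a₂ a₃) W /
          mW (Function.update p f 1) ends a₁ a₂ v W := by
  rw [Finset.sum_congr rfl (fun W _ => term_leaf_split hp hf hleaf h3v o a₁ a₂ b W),
    Finset.sum_add_distrib, Finset.sum_ite_eq', if_pos (Finset.mem_univ _), Finset.mul_sum]

/-- **The `σ_b`-sum splits at the leaf.** -/
lemma sum_Ssig_leaf {p : E → R} (hp : IsProbVec p) (hf : ends f = s(a₃, v))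
    (hleaf : ∀ e, a₃ ∈ ends e → e = f) (h3v : a₃ ≠ v) (a₁ a₂ b : V) :
    ∑ W : Finset V, Ssig p ends a₁ a₂ a₃ b W =
      Ssig p ends a₁ a₂ a₃ b {a₃} + p f * ∑ W : Finset V, Ssig (Function.update p f 1) ends a₁ a₂ v b W := by
  rw [Finset.sum_congr rfl (fun W _ => Ssig_leaf_split hp hf hleaf h3v a₁ a₂ b W),
    Finset.sum_add_distrib, Finset.sum_ite_eq', if_pos (Finset.mem_univ _), Finset.mul_sum]

/-- **The `F`-sum splits at the leaf.** -/
lemma sum_SF_leaf {p : E → R} (hp : IsProbVec p) (hf : ends f = s(a₃, v))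
    (hleaf : ∀ e, a₃ ∈ ends e → e = f) (h3v : a₃ ≠ v) (o a₁ a₂ : V) :
    ∑ W : Finset V, SF p ends o a₁ a₂ a₃ W =
      SF p ends o a₁ a₂ a₃ {a₃} + p f * ∑ W : Finset V,
        RootEdge.SFg (Function.update p f 1) ends o a₁ a₂ v (gamma p ends o a₁ a₂ a₃) W := by
  rw [Finset.sum_congr rfl (fun W _ => SF_leaf_split hp hf hleaf h3v o a₁ a₂ W),
    Finset.sum_add_distrib, Finset.sum_ite_eq', if_pos (Finset.mem_univ _), Finset.mul_sum]

/-- **The `A`-ratio sum splits at the leaf.** -/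
lemma sum_termA_leaf {p : E → R} (hp : IsProbVec p) (hf : ends f = s(a₃, v))
    (hleaf : ∀ e, a₃ ∈ ends e → e = f) (h3v : a₃ ≠ v) {a₁ a₂ : V} (h31 : a₃ ≠ a₁) (h32 : a₃ ≠ a₂)
    (o b : V) :
    ∑ W ∈ fibresA a₁ a₂, Su p ends a₁ a₂ a₃ b W * Su p ends a₁ a₂ a₃ o W / mW p ends a₁ a₂ a₃ W =
      Su p ends a₁ a₂ a₃ b {a₃} * Su p ends a₁ a₂ a₃ o {a₃} / mW p ends a₁ a₂ a₃ {a₃} +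
        p f * ∑ W ∈ fibresA a₁ a₂, Su (Function.update p f 1) ends a₁ a₂ v b W *
          Su (Function.update p f 1) ends a₁ a₂ v o W / mW (Function.update p f 1) ends a₁ a₂ v W := by
  rw [Finset.sum_congr rfl (fun W _ => termA_leaf_split hp hf hleaf h3v o a₁ a₂ b W),
    Finset.sum_add_distrib, Finset.sum_ite_eq', if_pos (singleton_mem_fibresA h31 h32), Finset.mul_sum]

/-- **The `A`-sum of `Su_x` splits at the leaf.** -/
lemma sum_SuA_leaf {p : E → R} (hp : IsProbVec p) (hf : ends f = s(a₃, v))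
    (hleaf : ∀ e, a₃ ∈ ends e → e = f) (h3v : a₃ ≠ v) {a₁ a₂ : V} (h31 : a₃ ≠ a₁) (h32 : a₃ ≠ a₂)
    (x : V) :
    ∑ W ∈ fibresA a₁ a₂, Su p ends a₁ a₂ a₃ x W =
      Su p ends a₁ a₂ a₃ x {a₃} + p f * ∑ W ∈ fibresA a₁ a₂, Su (Function.update p f 1) ends a₁ a₂ v x W := by
  rw [Finset.sum_congr rfl (fun W _ => Su_leaf_split hp hf hleaf h3v a₁ a₂ x W),
    Finset.sum_add_distrib, Finset.sum_ite_eq', if_pos (singleton_mem_fibresA h31 h32), Finset.mul_sum]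

omit [LinearOrder R] [IsStrictOrderedRing R] in
/-- **The `A`-sum of `m_W` splits at the leaf**: `D = m_{a₃} + t · D_v(p₁)`. -/
lemma prob_PD_leaf_free (p : E → R) (hf : ends f = s(a₃, v)) (hleaf : ∀ e, a₃ ∈ ends e → e = f)
    (h3v : a₃ ≠ v) {a₁ a₂ : V} (h31 : a₃ ≠ a₁) (h32 : a₃ ≠ a₂) :
    prob p (PDEvent ends a₁ a₂ a₃) =
      mW p ends a₁ a₂ a₃ {a₃} + p f * prob (Function.update p f 1) (PDEvent ends a₁ a₂ v) := by
  rw [prob_PD_eq_fibresA, prob_PD_eq_fibresA,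
    Finset.sum_congr rfl (fun W _ => mW_leaf_split p hf hleaf h3v a₁ a₂ W),
    Finset.sum_add_distrib, Finset.sum_ite_eq', if_pos (singleton_mem_fibresA h31 h32), Finset.mul_sum]

end LeafSumsFree

end A3Fibre

end CovForm

end Summit.Ventures.PercRepro2
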